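import Summits.Ventures.PercRepro.ProfilePointedCircuitClassesTwelveSeriesA

/-!
# PercRepro — THE SERIES-PAIR REDUCTION OF THE TWELVE-POINT STATEMENT, II: THE COUNTING BIJECTIONS AND THE REDUCTION
(p5, gen 44; `proofs/P5-GM1.md` §66)

On the facts of ProfilePointedCircuitClassesTwelveSeriesA (a series pair `{a, a'}` of `N`, the swap `W ↦ W − a + a'`,
the transfers to `N' := N ／ a` and `N₁ := N ／ a ∖ a'`) the counts of bi-independent sets are compared by explicit
bijections (`card_bij`): the swap count (`card_filter_swap_of_seriesPair`), the sets of `N'` avoiding / containing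
`a'` (`card_filter_contract_eq_of_seriesPair`, `card_filter_contract_insert_eq_of_seriesPair`), the sets of `N₁`
lifted by `a'` / `a` (`card_filter_minor_insert_right_eq_of_seriesPair`, `…_left_…`), and the two-point
complementation `X ↦ E ∖ X` (`card_filter_sdiff_two_eq`).  THE REDUCTION
(`inCount_five_le_outCount_six_of_seriesPair_of_star`): on `#E = 12`, `ρ(E) = 7`, with a series pair `{a, a'}`
avoiding `e`, `in_5(e) = d₀ + 2·d₁ ≤ u₀ + 2·u₁ + u₂ = out_6(e)` follows from `d₁ ≤ u₁` (the `n = 10` theorem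
`inOutBottomFour_holds` on `N₁`) and the two-point inequality `in_5^{N'}(e) ≤ in_5^{N'}(a') + thru_5^{N'}({e, a'})`
on the `11`-point minor `N'` (which gives `d₀ ≤ u₂ + u₀`).
-/

open scoped Matroid

namespace PercRepro.Cogirth

open Finset ThmH Skew Shadow Profile

variable {α : Type} [DecidableEq α] {N : Matroid α} [N.Finite]

section TwelveSeriesB

/-! ### The counting bijections -/

/-- A finset of sets filtered by a predicate splits into the four cells of the membership of two points `x, y`. -/
theorem card_filter_eq_sum_four (s : Finset (Finset α)) (p : Finset α → Prop) [DecidablePred p] (x y : α) :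
    (s.filter p).card =
      (s.filter (fun W => (p W ∧ x ∈ W) ∧ y ∈ W)).card + (s.filter (fun W => (p W ∧ x ∈ W) ∧ y ∉ W)).card +
      ((s.filter (fun W => (p W ∧ x ∉ W) ∧ y ∈ W)).card + (s.filter (fun W => (p W ∧ x ∉ W) ∧ y ∉ W)).card) := by
  have h1 := card_filter_add_card_filter_not (s := s.filter p) (fun W => x ∈ W)
  have h2 := card_filter_add_card_filter_not (s := (s.filter p).filter (fun W => x ∈ W)) (fun W => y ∈ W)
  have h3 := card_filter_add_card_filter_not (s := (s.filter p).filter (fun W => x ∉ W)) (fun W => y ∈ W)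
  simp only [filter_filter] at h1 h2 h3
  omega

/-- A finset of sets filtered by a predicate splits by the membership of one point `y`. -/
theorem card_filter_eq_sum_two (s : Finset (Finset α)) (p : Finset α → Prop) [DecidablePred p] (y : α) :
    (s.filter p).card = (s.filter (fun W => p W ∧ y ∈ W)).card + (s.filter (fun W => p W ∧ y ∉ W)).card := by
  have h1 := card_filter_add_card_filter_not (s := s.filter p) (fun W => y ∈ W)
  simp only [filter_filter] at h1
  omega

/-- **THE SWAP COUNT**: the bi-independent `k`-sets with `a ∈ W`, `a' ∉ W` and a swap-invariant property `P` are as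
many as those with `a' ∈ W`, `a ∉ W` and `P`. -/
theorem card_filter_swap_of_seriesPair {a a' : α} (h : SeriesPair N a a') (k : ℕ) (P : Finset α → Prop)
    [DecidablePred P] (hP : ∀ W, P (insert a' (W.erase a)) ↔ P W) (hP' : ∀ W, P (insert a (W.erase a')) ↔ P W) :
    ((biIndepSets N k).filter (fun W => (P W ∧ a ∈ W) ∧ a' ∉ W)).card =
      ((biIndepSets N k).filter (fun W => (P W ∧ a ∉ W) ∧ a' ∈ W)).card := by
  have hne : a ≠ a' := h.2.2.1
  apply card_bij (fun W _ => insert a' (W.erase a))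
  · intro W hW
    rw [mem_filter] at hW ⊢
    obtain ⟨hWb, ⟨hPW, haW⟩, ha'W⟩ := hW
    exact ⟨swap_mem_biIndepSets_of_seriesPair h hWb haW ha'W, ⟨(hP W).2 hPW,
      fun h' => (mem_insert.1 h').elim (fun h'' => hne h'') (fun h'' => (mem_erase.1 h'').1 rfl)⟩,
      mem_insert_self _ _⟩
  · intro W₁ hW₁ W₂ hW₂ heq
    rw [mem_filter] at hW₁ hW₂
    have heq' : insert a' (W₁.erase a) = insert a' (W₂.erase a) := heq
    have ha'₁ : a' ∉ W₁.erase a := fun h' => hW₁.2.2 (mem_of_mem_erase h')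
    have ha'₂ : a' ∉ W₂.erase a := fun h' => hW₂.2.2 (mem_of_mem_erase h')
    have h1 : W₁.erase a = W₂.erase a := by
      rw [← erase_insert ha'₁, ← erase_insert ha'₂, heq']
    rw [← insert_erase hW₁.2.1.2, ← insert_erase hW₂.2.1.2, h1]
  · intro V hV
    rw [mem_filter] at hV
    obtain ⟨hVb, ⟨hPV, haV⟩, ha'V⟩ := hV
    have haV' : a ∉ V.erase a' := fun h' => haV (mem_of_mem_erase h')
    refine ⟨insert a (V.erase a'), ?_, ?_⟩
    · rw [mem_filter]
      exact ⟨swap_mem_biIndepSets_of_seriesPair h.symm hVb ha'V haV, ⟨(hP' V).2 hPV, mem_insert_self _ _⟩,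
        fun h' => (mem_insert.1 h').elim (fun h'' => hne h''.symm) (fun h'' => (mem_erase.1 h'').1 rfl)⟩
    · show insert a' ((insert a (V.erase a')).erase a) = V
      rw [erase_insert haV', insert_erase ha'V]

/-- **THE `N ／ a` COUNT OF THE SETS AVOIDING `a'`**: they are the bi-independent sets of `N` avoiding `a, a'`. -/
theorem card_filter_contract_eq_of_seriesPair {a a' : α} (h : SeriesPair N a a') (k : ℕ) (P : Finset α → Prop)
    [DecidablePred P] :
    ((biIndepSets (N ／ ({a} : Set α)) k).filter (fun W => P W ∧ a' ∉ W)).card =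
      ((biIndepSets N k).filter (fun W => (P W ∧ a ∉ W) ∧ a' ∉ W)).card := by
  have hgr : gr (N ／ ({a} : Set α)) = (gr N).erase a := gr_contract'
  apply card_bij (fun W _ => W)
  · intro W hW
    rw [mem_filter] at hW ⊢
    obtain ⟨hWb, hPW, ha'W⟩ := hW
    have hWg : W ⊆ (gr N).erase a := by rw [← hgr]; exact (mem_biIndepSets.1 hWb).1
    have haW : a ∉ W := fun h' => (mem_erase.1 (hWg h')).1 rfl
    exact ⟨(mem_biIndepSets_contract_iff_of_seriesPair h hWg ha'W).1 hWb, ⟨hPW, haW⟩, ha'W⟩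
  · intro W₁ _ W₂ _ heq
    exact heq
  · intro W hW
    rw [mem_filter] at hW
    obtain ⟨hWb, ⟨hPW, haW⟩, ha'W⟩ := hW
    have hWg : W ⊆ (gr N).erase a :=
      fun y hy => mem_erase.2 ⟨fun h' => haW (h' ▸ hy), (mem_biIndepSets.1 hWb).1 hy⟩
    exact ⟨W, mem_filter.2 ⟨(mem_biIndepSets_contract_iff_of_seriesPair h hWg ha'W).2 hWb, hPW, ha'W⟩, rfl⟩

/-- **THE `N ／ a` COUNT OF THE SETS CONTAINING `a'`**: they are the traces `S − a` of the bi-independent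
`(k+1)`-sets `S ∋ a, a'` of `N`. -/
theorem card_filter_contract_insert_eq_of_seriesPair {a a' : α} (h : SeriesPair N a a') (k : ℕ)
    (P : Finset α → Prop) [DecidablePred P] (hP : ∀ W, P (insert a W) ↔ P W) :
    ((biIndepSets (N ／ ({a} : Set α)) k).filter (fun W => P W ∧ a' ∈ W)).card =
      ((biIndepSets N (k + 1)).filter (fun S => (P S ∧ a ∈ S) ∧ a' ∈ S)).card := by
  have hgr : gr (N ／ ({a} : Set α)) = (gr N).erase a := gr_contract'
  apply card_bij (fun W _ => insert a W)
  · intro W hW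
    rw [mem_filter] at hW ⊢
    obtain ⟨hWb, hPW, ha'W⟩ := hW
    have hWg : W ⊆ (gr N).erase a := by rw [← hgr]; exact (mem_biIndepSets.1 hWb).1
    exact ⟨(mem_biIndepSets_contract_iff_insert_of_seriesPair h hWg ha'W).1 hWb, ⟨(hP W).2 hPW,
      mem_insert_self _ _⟩, mem_insert_of_mem ha'W⟩
  · intro W₁ hW₁ W₂ hW₂ heq
    rw [mem_filter] at hW₁ hW₂
    have h₁ : W₁ ⊆ (gr N).erase a := by rw [← hgr]; exact (mem_biIndepSets.1 hW₁.1).1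
    have h₂ : W₂ ⊆ (gr N).erase a := by rw [← hgr]; exact (mem_biIndepSets.1 hW₂.1).1
    have ha₁ : a ∉ W₁ := fun h' => (mem_erase.1 (h₁ h')).1 rfl
    have ha₂ : a ∉ W₂ := fun h' => (mem_erase.1 (h₂ h')).1 rfl
    have heq' : insert a W₁ = insert a W₂ := heq
    rw [← erase_insert ha₁, ← erase_insert ha₂, heq']
  · intro S hS
    rw [mem_filter] at hS
    obtain ⟨hSb, ⟨hPS, haS⟩, ha'S⟩ := hS
    have hSg : S ⊆ gr N := (mem_biIndepSets.1 hSb).1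
    have hWg : S.erase a ⊆ (gr N).erase a := erase_subset_erase a hSg
    have ha'W : a' ∈ S.erase a := mem_erase.2 ⟨h.2.2.1.symm, ha'S⟩
    refine ⟨S.erase a, ?_, insert_erase haS⟩
    rw [mem_filter]
    refine ⟨(mem_biIndepSets_contract_iff_insert_of_seriesPair h hWg ha'W).2 (by rw [insert_erase haS]; exact hSb),
      ?_, ha'W⟩
    exact (hP _).1 (by rw [insert_erase haS]; exact hPS)

/-- **THE `N ／ a ∖ a'` COUNT, LIFTED BY `a'`**: the bi-independent `k`-sets of the minor with a property `P` are the
bi-independent `(k+1)`-sets of `N` containing `a'` but not `a` with `P`. -/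
theorem card_filter_minor_insert_right_eq_of_seriesPair {a a' : α} (h : SeriesPair N a a') (k : ℕ)
    (P : Finset α → Prop) [DecidablePred P] (hP : ∀ Y, P (insert a' Y) ↔ P Y) :
    ((biIndepSets ((N ／ ({a} : Set α)) ＼ ({a'} : Set α)) k).filter P).card =
      ((biIndepSets N (k + 1)).filter (fun W => (P W ∧ a ∉ W) ∧ a' ∈ W)).card := by
  have hgr : gr ((N ／ ({a} : Set α)) ＼ ({a'} : Set α)) = ((gr N).erase a).erase a' :=
    gr_minor_of_seriesPair a a'
  apply card_bij (fun Y _ => insert a' Y)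
  · intro Y hY
    rw [mem_filter] at hY ⊢
    obtain ⟨hYb, hPY⟩ := hY
    have hYg : Y ⊆ ((gr N).erase a).erase a' := by rw [← hgr]; exact (mem_biIndepSets.1 hYb).1
    have haY : a ∉ Y := fun h' => (mem_erase.1 (mem_of_mem_erase (hYg h'))).1 rfl
    exact ⟨(mem_biIndepSets_minor_iff_insert_right_of_seriesPair h hYg).1 hYb, ⟨(hP Y).2 hPY,
      fun h' => (mem_insert.1 h').elim (fun h'' => h.2.2.1 h'') haY⟩, mem_insert_self _ _⟩
  · intro Y₁ hY₁ Y₂ hY₂ heq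
    rw [mem_filter] at hY₁ hY₂
    have h₁ : Y₁ ⊆ ((gr N).erase a).erase a' := by rw [← hgr]; exact (mem_biIndepSets.1 hY₁.1).1
    have h₂ : Y₂ ⊆ ((gr N).erase a).erase a' := by rw [← hgr]; exact (mem_biIndepSets.1 hY₂.1).1
    have ha₁ : a' ∉ Y₁ := fun h' => (mem_erase.1 (h₁ h')).1 rfl
    have ha₂ : a' ∉ Y₂ := fun h' => (mem_erase.1 (h₂ h')).1 rfl
    have heq' : insert a' Y₁ = insert a' Y₂ := heq
    rw [← erase_insert ha₁, ← erase_insert ha₂, heq']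
  · intro W hW
    rw [mem_filter] at hW
    obtain ⟨hWb, ⟨hPW, haW⟩, ha'W⟩ := hW
    have hWg : W ⊆ gr N := (mem_biIndepSets.1 hWb).1
    have hYg : W.erase a' ⊆ ((gr N).erase a).erase a' := by
      intro y hy
      rw [mem_erase] at hy
      exact mem_erase.2 ⟨hy.1, mem_erase.2 ⟨fun h' => haW (h' ▸ hy.2), hWg hy.2⟩⟩
    refine ⟨W.erase a', ?_, insert_erase ha'W⟩
    rw [mem_filter]
    exact ⟨(mem_biIndepSets_minor_iff_insert_right_of_seriesPair h hYg).2 (by rw [insert_erase ha'W]; exact hWb),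
      (hP _).1 (by rw [insert_erase ha'W]; exact hPW)⟩

/-- **THE `N ／ a ∖ a'` COUNT, LIFTED BY `a`**: the bi-independent `k`-sets of the minor with a property `P` are the
bi-independent `(k+1)`-sets of `N` containing `a` but not `a'` with `P`. -/
theorem card_filter_minor_insert_left_eq_of_seriesPair {a a' : α} (h : SeriesPair N a a') (k : ℕ)
    (P : Finset α → Prop) [DecidablePred P] (hP : ∀ Y, P (insert a Y) ↔ P Y) :
    ((biIndepSets ((N ／ ({a} : Set α)) ＼ ({a'} : Set α)) k).filter P).card =
      ((biIndepSets N (k + 1)).filter (fun W => (P W ∧ a ∈ W) ∧ a' ∉ W)).card := by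
  have hgr : gr ((N ／ ({a} : Set α)) ＼ ({a'} : Set α)) = ((gr N).erase a).erase a' :=
    gr_minor_of_seriesPair a a'
  apply card_bij (fun Y _ => insert a Y)
  · intro Y hY
    rw [mem_filter] at hY ⊢
    obtain ⟨hYb, hPY⟩ := hY
    have hYg : Y ⊆ ((gr N).erase a).erase a' := by rw [← hgr]; exact (mem_biIndepSets.1 hYb).1
    have ha'Y : a' ∉ Y := fun h' => (mem_erase.1 (hYg h')).1 rfl
    exact ⟨(mem_biIndepSets_minor_iff_insert_left_of_seriesPair h hYg).1 hYb, ⟨(hP Y).2 hPY,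
      mem_insert_self _ _⟩, fun h' => (mem_insert.1 h').elim (fun h'' => h.2.2.1 h''.symm) ha'Y⟩
  · intro Y₁ hY₁ Y₂ hY₂ heq
    rw [mem_filter] at hY₁ hY₂
    have h₁ : Y₁ ⊆ ((gr N).erase a).erase a' := by rw [← hgr]; exact (mem_biIndepSets.1 hY₁.1).1
    have h₂ : Y₂ ⊆ ((gr N).erase a).erase a' := by rw [← hgr]; exact (mem_biIndepSets.1 hY₂.1).1
    have ha₁ : a ∉ Y₁ := fun h' => (mem_erase.1 (mem_of_mem_erase (h₁ h'))).1 rfl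
    have ha₂ : a ∉ Y₂ := fun h' => (mem_erase.1 (mem_of_mem_erase (h₂ h'))).1 rfl
    have heq' : insert a Y₁ = insert a Y₂ := heq
    rw [← erase_insert ha₁, ← erase_insert ha₂, heq']
  · intro W hW
    rw [mem_filter] at hW
    obtain ⟨hWb, ⟨hPW, haW⟩, ha'W⟩ := hW
    have hWg : W ⊆ gr N := (mem_biIndepSets.1 hWb).1
    have hYg : W.erase a ⊆ ((gr N).erase a).erase a' := by
      intro y hy
      rw [mem_erase] at hy
      exact mem_erase.2 ⟨fun h' => ha'W (h' ▸ hy.2), mem_erase.2 ⟨hy.1, hWg hy.2⟩⟩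
    refine ⟨W.erase a, ?_, insert_erase haW⟩
    rw [mem_filter]
    exact ⟨(mem_biIndepSets_minor_iff_insert_left_of_seriesPair h hYg).2 (by rw [insert_erase haW]; exact hWb),
      (hP _).1 (by rw [insert_erase haW]; exact hPW)⟩

/-- **TWO-POINT COMPLEMENTATION**: the bi-independent `k`-sets avoiding two points `p, q` are as many as the
bi-independent `(n − k)`-sets containing both (`X ↦ E ∖ X`). -/
theorem card_filter_sdiff_two_eq {M : Matroid α} [M.Finite] {k : ℕ} {p q : α} (hp : p ∈ gr M) (hq : q ∈ gr M)
    (hk : k ≤ (gr M).card) :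
    ((biIndepSets M k).filter (fun S => p ∉ S ∧ q ∉ S)).card =
      ((biIndepSets M ((gr M).card - k)).filter (fun W => p ∈ W ∧ q ∈ W)).card := by
  apply card_bij (fun X _ => gr M \ X)
  · intro X hX
    rw [mem_filter] at hX ⊢
    exact ⟨sdiff_mem_biIndepSets hX.1, mem_sdiff.2 ⟨hp, hX.2.1⟩, mem_sdiff.2 ⟨hq, hX.2.2⟩⟩
  · intro X₁ hX₁ X₂ hX₂ heq
    have h₁ : X₁ ⊆ gr M := (mem_biIndepSets.1 (mem_filter.1 hX₁).1).1
    have h₂ : X₂ ⊆ gr M := (mem_biIndepSets.1 (mem_filter.1 hX₂).1).1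
    rw [← Finset.sdiff_sdiff_eq_self h₁, ← Finset.sdiff_sdiff_eq_self h₂, heq]
  · intro Y hY
    rw [mem_filter] at hY
    have hYg : Y ⊆ gr M := (mem_biIndepSets.1 hY.1).1
    refine ⟨gr M \ Y, ?_, Finset.sdiff_sdiff_eq_self hYg⟩
    rw [mem_filter]
    refine ⟨?_, fun h => (mem_sdiff.1 h).2 hY.2.1, fun h => (mem_sdiff.1 h).2 hY.2.2⟩
    have := sdiff_mem_biIndepSets hY.1
    rwa [Nat.sub_sub_self hk] at this

/-! ### The reduction -/

/-- **THE SERIES-PAIR REDUCTION OF THE TWELVE-POINT STATEMENT**: on `#E = 12`, `ρ(E) = 7`, with a series pair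
`{a, a'}` avoiding `e`, the inequality `in_5(e) ≤ out_6(e)` follows from the two-point inequality
`in_5(e) ≤ in_5(a') + thru_5({e, a'})` on the `11`-point minor `N' := N ／ a` (rank `6`).  Proof: with
`N₁ := N' ∖ a'` (`10` points, rank `6`), `in_5(e) = d₀ + 2·d₁` and `out_6(e) = u₀ + 2·u₁ + u₂` where
`d₁ = in_4^{N₁}(e) ≤ out_5^{N₁}(e) = u₁` (`inOutBottomFour_holds`), and the two-point inequality on `N'` reads
`d₀ ≤ u₂ + u₀` after the transfers and the complementation `u₀ = #{W ∈ BI_5(N') : e, a' ∈ W}`. -/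
theorem inCount_five_le_outCount_six_of_seriesPair_of_star {a a' e : α} (hn : (gr N).card = 12)
    (hR : rk N (gr N) = 7) (h : SeriesPair N a a') (he : e ∈ gr N) (hea : e ≠ a) (hea' : e ≠ a')
    (hstar : inCount (N ／ ({a} : Set α)) 5 e ≤
      inCount (N ／ ({a} : Set α)) 5 a' + thruCount (N ／ ({a} : Set α)) 5 {e, a'}) :
    inCount N 5 e ≤ outCount N 6 e := by
  have ha : a ∈ gr N := h.1
  have ha' : a' ∈ gr N := h.2.1
  have hne : a ≠ a' := h.2.2.1
  have hgr' : gr (N ／ ({a} : Set α)) = (gr N).erase a := gr_contract'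
  have hcard' : (gr (N ／ ({a} : Set α))).card = 11 := by
    rw [hgr', card_erase_of_mem ha, hn]
  have he' : e ∈ gr (N ／ ({a} : Set α)) := by rw [hgr']; exact mem_erase.2 ⟨hea, he⟩
  have ha'' : a' ∈ gr (N ／ ({a} : Set α)) := by rw [hgr']; exact mem_erase.2 ⟨hne.symm, ha'⟩
  -- the membership predicates, swap-invariant
  have hPe : ∀ W : Finset α, e ∈ insert a' (W.erase a) ↔ e ∈ W := by
    intro W
    rw [mem_insert, mem_erase]
    constructor
    · rintro (h' | ⟨_, h'⟩)
      · exact absurd h' hea'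
      · exact h'
    · intro h'
      exact Or.inr ⟨hea, h'⟩
  have hPe' : ∀ W : Finset α, e ∈ insert a (W.erase a') ↔ e ∈ W := by
    intro W
    rw [mem_insert, mem_erase]
    constructor
    · rintro (h' | ⟨_, h'⟩)
      · exact absurd h' hea
      · exact h'
    · intro h'
      exact Or.inr ⟨hea', h'⟩
  have hQe : ∀ W : Finset α, e ∉ insert a' (W.erase a) ↔ e ∉ W := fun W => not_congr (hPe W)
  have hQe' : ∀ W : Finset α, e ∉ insert a (W.erase a') ↔ e ∉ W := fun W => not_congr (hPe' W)
  have hIa : ∀ W : Finset α, e ∉ insert a W ↔ e ∉ W := by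
    intro W
    rw [mem_insert, not_or]
    exact ⟨fun h' => h'.2, fun h' => ⟨hea, h'⟩⟩
  have hIa' : ∀ W : Finset α, e ∈ insert a' W ↔ e ∈ W := by
    intro W
    rw [mem_insert]
    exact ⟨fun h' => h'.resolve_left hea', fun h' => Or.inr h'⟩
  -- the decompositions in `N`
  have hD := card_filter_eq_sum_four (biIndepSets N 5) (fun W => e ∈ W) a a'
  have hU := card_filter_eq_sum_four (biIndepSets N 6) (fun W => e ∉ W) a a'
  have hn5 : (gr N).card = rk N (gr N) + 5 := by omega
  have hboth : ((biIndepSets N 5).filter (fun W => (e ∈ W ∧ a ∈ W) ∧ a' ∈ W)).card = 0 := by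
    rw [card_eq_zero, filter_eq_empty_iff]
    rintro W hW ⟨⟨_, haW⟩, ha'W⟩
    exact not_mem_of_mem_biIndepSets_of_seriesPair h hn5 hW haW ha'W
  have hD1 := card_filter_swap_of_seriesPair h 5 (fun W => e ∈ W) hPe hPe'
  have hU1 := card_filter_swap_of_seriesPair h 6 (fun W => e ∉ W) hQe hQe'
  -- the `10`-point minor
  have hN₁n := card_gr_minor_add_two_of_seriesPair h
  have hN₁r := rk_gr_minor_add_one_of_seriesPair h
  have he₁ : e ∈ gr ((N ／ ({a} : Set α)) ＼ ({a'} : Set α)) := by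
    rw [gr_minor_of_seriesPair]
    exact mem_erase.2 ⟨hea', mem_erase.2 ⟨hea, he⟩⟩
  have h10 := inOutBottomFour_holds (α := α) ((N ／ ({a} : Set α)) ＼ ({a'} : Set α)) e he₁ (by omega) (by omega)
  unfold inCount outCount at h10
  rw [card_filter_minor_insert_right_eq_of_seriesPair h 4 (fun Y => e ∈ Y) hIa',
    card_filter_minor_insert_left_eq_of_seriesPair h 5 (fun Y => e ∉ Y) hIa] at h10
  simp only [Nat.reduceAdd] at h10
  -- the `11`-point minor: the transfers
  have hD0 := card_filter_contract_eq_of_seriesPair h 5 (fun W => e ∈ W)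
  have hU0 := card_filter_contract_eq_of_seriesPair h 6 (fun W => e ∉ W)
  have hU2 := card_filter_contract_insert_eq_of_seriesPair h 5 (fun W => e ∉ W) hIa
  simp only [Nat.reduceAdd] at hU2
  have hU0' := card_filter_sdiff_two_eq (M := N ／ ({a} : Set α)) (k := 6) he' ha'' (by omega)
  rw [hcard', show (11 : ℕ) - 6 = 5 by norm_num] at hU0'
  -- the two-point inequality, unfolded
  have hstar' := hstar
  unfold inCount thruCount at hstar'
  rw [card_filter_eq_sum_two (biIndepSets (N ／ ({a} : Set α)) 5) (fun W => e ∈ W) a',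
    card_filter_eq_sum_two (biIndepSets (N ／ ({a} : Set α)) 5) (fun W => a' ∈ W) e] at hstar'
  have hthru : ((biIndepSets (N ／ ({a} : Set α)) 5).filter (fun W => ({e, a'} : Finset α) ⊆ W)).card =
      ((biIndepSets (N ／ ({a} : Set α)) 5).filter (fun W => e ∈ W ∧ a' ∈ W)).card := by
    exact congrArg Finset.card (filter_congr (fun W _ => by rw [insert_subset_iff, singleton_subset_iff]))
  have hcomm : ((biIndepSets (N ／ ({a} : Set α)) 5).filter (fun W => a' ∈ W ∧ e ∈ W)).card =
      ((biIndepSets (N ／ ({a} : Set α)) 5).filter (fun W => e ∈ W ∧ a' ∈ W)).card := by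
    exact congrArg Finset.card (filter_congr (fun W _ => and_comm))
  have hcomm' : ((biIndepSets (N ／ ({a} : Set α)) 5).filter (fun W => a' ∈ W ∧ e ∉ W)).card =
      ((biIndepSets (N ／ ({a} : Set α)) 5).filter (fun W => e ∉ W ∧ a' ∈ W)).card := by
    exact congrArg Finset.card (filter_congr (fun W _ => and_comm))
  rw [hthru, hcomm, hcomm'] at hstar'
  unfold inCount outCount
  rw [hD, hU, hboth, hD1, hU1]
  rw [hD0] at hstar'
  rw [hU2] at hstar'
  rw [hU0'] at hU0
  omega


end TwelveSeriesB

end PercRepro.Cogirth
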